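import Literature.NumberTheory.Transcendental.RoySmallValueDeterminant
import Literature.NumberTheory.Transcendental.RoySmallValueMatrixMult
import Literature.NumberTheory.Transcendental.RoySmallValueVanishing
import Literature.NumberTheory.Transcendental.RoySmallValueInterpolationIso
import Literature.NumberTheory.Transcendental.RoySmallValueZeros
import HarnessLib

/-!
# Roy's small value estimate for `𝔾ₐ × 𝔾ₘ` — `Φ` vanishes to order `T` along lines from `(I_D^{(γ,T)})³`

Topic `Literature/NumberTheory/Transcendental`. Part of the formalisation of the proof of Roy 2013,
Theorem 1.1 (named fact `roy2013_thm_1_1`, `RoySmallValueEstimates.lean`), seat B. Source: D. Roy,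
*A small value estimate for `𝔾ₐ × 𝔾ₘ`*, Mathematika 59 (2013) 333–363 = arXiv:1301.0663, §5,
proof of Theorem 5.2 (p. 13): "For each `Q ∈ I_D^{m+1}`, the first `deg(I)` rows of `M_Q` vanish
because the image of `φ_Q` is contained in `I_ν`. It follows from this that all partial
derivatives of `Φ` of order less than `deg(I)` vanish at each point of `I_D^{m+1}`", combined
with Corollary 5.7 (the case `I = I^{(γ,T)}`, `deg I = T`) in the one-variable form in which
Proposition 6.1 uses it ("the polynomial `f(z) = Res_D(…)` vanishes to order at least `T` at
`z = 0`").

For the determinant `Φ` of `RoySmallValueDeterminant.lean` we prove exactly this one-variable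
statement, WITHOUT passing through the resultant: if `Q₀, Q₁, Q₂ ∈ ℂ[X]_D` lie in the ideal
`I^{(γ',T)}` (`vanIdeal ξ' η' T`, `η' ≠ 0`) and `T ≤ binom(3D+2, 2)`, then for every triple `S` of
forms of degree `D`, **`X^T` divides `Ψ_{Q,S} = det(M_Q + X M_S)`**, so that
`Φ(Q + zS) = z^T Ψ₁(z)` (`X_pow_dvd_linePoly`, `exists_phi_add_smul_eq`). The `T` linear
functionals are the jets `f ↦ 𝒟ᵗf(1, γ')`, `t < T`, on `ℂ[X]_{3D}` (matrix `jetMatrix`); they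
admit a right inverse by the interpolation isomorphism of Proposition 3.3
(`exists_isHomogeneous_iterate_homD_eq`), and they kill the columns of `M_Q` because
`X^ν Q_k ∈ I^{(γ',T)}`; the divisibility is then `X_pow_card_dvd_det_line`
(`RoySmallValueMatrixMult.lean`).

Everything is proved; the definitions (`jetMatrix`) have bodies; no named facts.

## References

* [Roy2013] D. Roy, *A small value estimate for 𝔾ₐ × 𝔾ₘ*, Mathematika 59 (2013), 333–363
  (arXiv:1301.0663), §5, proof of Theorem 5.2 and Corollary 5.7; §6, proof of Prop. 6.1.
-/

noncomputable section

open MvPolynomial Finset Matrix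

namespace Literature.NumberTheory.Transcendental

namespace Roy2013

/-! ### Forms of degree `n` from their coefficients on `Mon n` -/

/-- A form of degree `n` is the sum of its terms indexed by `Mon n`. [folklore] -/
theorem eq_sum_coeff_smul_monomial {n : ℕ} {f : CX} (hf : f.IsHomogeneous n) :
    f = ∑ i : Mon n, coeff i.1 f • monomial i.1 (1 : ℂ) := by
  classical
  ext d
  rw [coeff_sum]
  simp_rw [coeff_smul, coeff_monomial, smul_eq_mul, mul_ite, mul_one, mul_zero]
  by_cases hd : d.degree = n
  · rw [Finset.sum_eq_single (⟨d, hd⟩ : Mon n)]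
    · rw [if_pos rfl]
    · intro i _ hi
      rw [if_neg]
      intro h
      exact hi (Subtype.ext h)
    · intro h; exact absurd (mem_univ _) h
  · rw [hf.coeff_eq_zero hd]
    symm
    refine Finset.sum_eq_zero fun i _ => ?_
    rw [if_neg]
    intro h
    exact hd (h ▸ i.2)

/-! ### The jet functionals on `ℂ[X]_{3D}` -/

/-- The matrix of the `T` jet functionals `f ↦ 𝒟ᵗf(1, ξ, η)` (`t < T`) on `ℂ[X]_n` in the monomial
basis. [cite: Roy2013, §5, proof of Thm 5.2 (the basis `𝓑` adapted to `I_ν`)] -/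
def jetMatrix (ξ η : ℂ) (T n : ℕ) : Matrix (Fin T) (Mon n) ℂ :=
  Matrix.of fun t i => aeval ![1, ξ, η] (homD^[t.1] (monomial i.1 (1 : ℂ)))

/-- The jet functionals applied to a coefficient vector give the jets of the form.
[cite: Roy2013, §5, proof of Thm 5.2] -/
theorem jetMatrix_mulVec_coeff (ξ η : ℂ) (T : ℕ) {n : ℕ} {f : CX} (hf : f.IsHomogeneous n)
    (t : Fin T) :
    (jetMatrix ξ η T n *ᵥ fun i : Mon n => coeff i.1 f) t = aeval ![1, ξ, η] (homD^[t.1] f) := by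
  conv_rhs => rw [eq_sum_coeff_smul_monomial hf]
  rw [iterate_homD_sum, map_sum, mulVec, dotProduct]
  refine Finset.sum_congr rfl fun i _ => ?_
  rw [jetMatrix, Matrix.of_apply, iterate_homD_smul, map_smul, smul_eq_mul, mul_comm]

/-- **A right inverse of the jet matrix** (Prop. 3.3: the jets of order `< binom(n+2,2)` of forms
of degree `n` can be prescribed). [cite: Roy2013, Prop. 3.3] -/
theorem exists_jetMatrix_rightInverse {ξ η : ℂ} (hη : η ≠ 0) {T n : ℕ} (hT : T ≤ (n + 2).choose 2) :
    ∃ N : Matrix (Mon n) (Fin T) ℂ, jetMatrix ξ η T n * N = 1 := by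
  classical
  -- for each `t < T` a form with jets `δ_{t,·}`
  have hforms : ∀ t : Fin T, ∃ f : CX, f.IsHomogeneous n ∧
      ∀ s < (n + 2).choose 2, aeval ![1, ξ, η] (homD^[s] f) = if s = t.1 then 1 else 0 :=
    fun t => exists_isHomogeneous_iterate_homD_eq n hη _
  choose f hf hjet using hforms
  refine ⟨Matrix.of fun i t => coeff i.1 (f t), ?_⟩
  ext t t'
  have h := jetMatrix_mulVec_coeff ξ η T (hf t') t
  rw [mulVec, dotProduct] at h
  rw [Matrix.mul_apply, Matrix.one_apply]
  simp only [Matrix.of_apply] at h ⊢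
  rw [h, hjet t' t.1 (lt_of_lt_of_le t.2 hT)]
  simp only [Fin.val_eq_val]

/-! ### Divisibility of the line polynomial -/

/-- The jet functionals kill the columns of `M_Q` when `Q₀, Q₁, Q₂ ∈ I^{(γ',T)}`.
[cite: Roy2013, §5, proof of Thm 5.2 ("the first `deg I` rows of `M_Q` vanish")] -/
theorem jetMatrix_mul_cMatrix_eq_zero {D : ℕ} {S₁ S₂ : Finset (Fin 3 →₀ ℕ)}
    (hS₁ : ∀ ν ∈ S₁, ν.degree = 2 * D) (hS₂ : ∀ ν ∈ S₂, ν.degree = 2 * D)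
    (h : Fintype.card (Mon (2 * D) ⊕ (S₁ ⊕ S₂)) = Fintype.card (Mon (3 * D)))
    {Q : Fin 3 → CX} (hQ : ∀ k, (Q k).IsHomogeneous D) {ξ η : ℂ} {T : ℕ}
    (hvan : ∀ k, Q k ∈ vanIdeal ξ η T) :
    jetMatrix ξ η T (3 * D) *
      Matrix.reindex (Equiv.refl _) (colEquiv D S₁ S₂ h) (cMatrix D S₁ S₂ Q) = 0 := by
  ext t c
  rw [Matrix.zero_apply, Matrix.mul_apply]
  simp only [reindex_apply, submatrix_apply, Equiv.refl_symm, Equiv.coe_refl, id, cMatrix_apply]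
  have hmem : colFamily D S₁ S₂ Q ((colEquiv D S₁ S₂ h).symm c) ∈ vanIdeal ξ η T := by
    rcases (colEquiv D S₁ S₂ h).symm c with ν | ν | ν <;>
      exact Ideal.mul_mem_left _ _ (hvan _)
  have hjet := jetMatrix_mulVec_coeff ξ η T
    (isHomogeneous_colFamily hS₁ hS₂ hQ ((colEquiv D S₁ S₂ h).symm c)) t
  rw [mulVec, dotProduct] at hjet
  rw [hjet]
  exact hmem t.1 t.2

/-- **`X^T` divides `Ψ_{Q,S}`** for `Q ∈ (I_D^{(γ',T)})³`, `T ≤ binom(3D+2, 2)`: Roy's "the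
resultant in degree `D` vanishes to order `T` at each triple of elements of `I_D^{(γ,T)}`"
(Cor. 5.7) for `Φ` restricted to a line. [cite: Roy2013, Cor. 5.7 and proof of Thm 5.2] -/
theorem X_pow_dvd_linePoly {D : ℕ} {S₁ S₂ : Finset (Fin 3 →₀ ℕ)}
    (hS₁ : ∀ ν ∈ S₁, ν.degree = 2 * D) (hS₂ : ∀ ν ∈ S₂, ν.degree = 2 * D)
    (h : Fintype.card (Mon (2 * D) ⊕ (S₁ ⊕ S₂)) = Fintype.card (Mon (3 * D)))
    {Q : Fin 3 → CX} (hQ : ∀ k, (Q k).IsHomogeneous D) (S : Fin 3 → CX) {ξ η : ℂ} (hη : η ≠ 0)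
    {T : ℕ} (hT : T ≤ (3 * D + 2).choose 2) (hvan : ∀ k, Q k ∈ vanIdeal ξ η T) :
    (Polynomial.X : Polynomial ℂ) ^ T ∣ linePoly D S₁ S₂ h Q S := by
  obtain ⟨N, hN⟩ := exists_jetMatrix_rightInverse hη hT
  have hdvd := X_pow_card_dvd_det_line (jetMatrix ξ η T (3 * D)) N hN
    (Matrix.reindex (Equiv.refl _) (colEquiv D S₁ S₂ h) (cMatrix D S₁ S₂ Q))
    (Matrix.reindex (Equiv.refl _) (colEquiv D S₁ S₂ h) (cMatrix D S₁ S₂ S))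
    (jetMatrix_mul_cMatrix_eq_zero hS₁ hS₂ h hQ hvan)
  rwa [Fintype.card_fin] at hdvd

/-- **`Φ(Q + zS) = z^T Ψ₁(z)`** for a polynomial `Ψ₁`, when `Q ∈ (I_D^{(γ',T)})³`,
`T ≤ binom(3D+2,2)` and `S ∈ (ℂ[X]_D)³`. [cite: Roy2013, Cor. 5.7; §6, proof of Prop. 6.1] -/
theorem exists_phi_add_smul_eq {D : ℕ} {S₁ S₂ : Finset (Fin 3 →₀ ℕ)}
    (hS₁ : ∀ ν ∈ S₁, ν.degree = 2 * D) (hS₂ : ∀ ν ∈ S₂, ν.degree = 2 * D)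
    (h : Fintype.card (Mon (2 * D) ⊕ (S₁ ⊕ S₂)) = Fintype.card (Mon (3 * D)))
    {Q S : Fin 3 → CX} (hQ : ∀ k, (Q k).IsHomogeneous D) (hS : ∀ k, (S k).IsHomogeneous D)
    {ξ η : ℂ} (hη : η ≠ 0) {T : ℕ} (hT : T ≤ (3 * D + 2).choose 2)
    (hvan : ∀ k, Q k ∈ vanIdeal ξ η T) :
    ∃ Ψ₁ : Polynomial ℂ, ∀ z : ℂ, phi D S₁ S₂ h (Q + z • S) = z ^ T * Ψ₁.eval z := by
  obtain ⟨Ψ₁, hΨ⟩ := X_pow_dvd_linePoly hS₁ hS₂ h hQ S hη hT hvan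
  exact ⟨Ψ₁, fun z => phi_add_smul_of_dvd S₁ S₂ h hQ hS hΨ z⟩

end Roy2013

end Literature.NumberTheory.Transcendental
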